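import Literature.AlgebraicGeometry.Frobenioids.ArchimedeanFSMIChainsR0
import Literature.AlgebraicGeometry.Frobenioids.ArchimedeanFSMIChainsA0
import Literature.AlgebraicGeometry.Frobenioids.ArchimedeanFSM
import HarnessLib

/-!
# Frobenioids II, Proposition 3.4 (viii): condition (b) of "FSMFF-type" for `F₀` at the three towers

Mochizuki, *The geometry of Frobenioids II: poly-Frobenioids*, Kyushu J. Math. **62** (2008)
401–460, §3, proof of Proposition 3.4 (viii), p. 32 l. 5 – p. 33 l. 16 [cite: MochizukiFrdII2008, Prop 3.4 (viii) p.32].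

PROOF-ONLY bridge file (abc-iut cell, layer L1, sub-DAG `SUBDAG-FrdII-Prop34.md` rows P34-L10/L11, seat
abc-iut-w5-d092): the results of `ArchimedeanFSMIChainsN0/R0/A0.lean` restated on the `F₀`-component of
abc-iut-L1-t6's towers `towerA π`, `towerN π`, `towerR π` (`ArchimedeanFSM.lean`), in the exact binder shape
of the revised condition (b) (`IsOfFSMFFType2024.bounded`) consumed by the transfer of row P34-L13
(`ArchimedeanFSMChainBound.lean`, abc-iut-w5-d152), together with the "complex domain and codomain / invertible
base" facts about FSMI-morphisms of `F₀` used by row P34-L14. Nothing new is proved here.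
[FrdII] §3 is classical and undisputed.
-/

namespace Literature.AlgebraicGeometry.Frobenioids

open CategoryTheory

noncomputable section

namespace ArchFrd

universe v u

variable {D : Type u} [Category.{v} D] (π : D ⥤ D0)

/-- **Condition (b) (2024 form) for `F₀ = A₀` of the tower `towerA`.** [cite: MochizukiFrdII2008, Prop 3.4 (viii) p.32] -/
theorem towerA_F0_bounded_headedFSMIChain (A : (towerA π).F0) :
    ∃ N : ℕ, ∀ {B : (towerA π).F0} (φ : A ⟶ B) (n : ℕ), IsHeadedFSMIChain ⊤ φ n → n ≤ N :=
  A0.bounded_headedFSMIChain A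

/-- **Condition (b) (2024 form) for `F₀ = N₀` of the tower `towerN`.** [cite: MochizukiFrdII2008, Prop 3.4 (viii) p.32] -/
theorem towerN_F0_bounded_headedFSMIChain (A : (towerN π).F0) :
    ∃ N : ℕ, ∀ {B : (towerN π).F0} (φ : A ⟶ B) (n : ℕ), IsHeadedFSMIChain ⊤ φ n → n ≤ N :=
  N0.bounded_headedFSMIChain A

/-- **Condition (b) (2024 form) for `F₀ = R₀` of the tower `towerR`.** [cite: MochizukiFrdII2008, Prop 3.4 (viii) p.32] -/
theorem towerR_F0_bounded_headedFSMIChain (A : (towerR π).F0) :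
    ∃ N : ℕ, ∀ {B : (towerR π).F0} (φ : A ⟶ B) (n : ℕ), IsHeadedFSMIChain ⊤ φ n → n ≤ N :=
  R0.bounded_headedFSMIChain A

/-- Condition (b) (printed 2008 form) for `F₀ = A₀` of `towerA`. [cite: MochizukiFrdII2008, Prop 3.4 (viii) p.32] -/
theorem towerA_F0_bounded_isFSMIChain (A : (towerA π).F0) :
    ∃ N : ℕ, ∀ {B : (towerA π).F0} (φ : A ⟶ B) (n : ℕ), IsFSMIChain φ n → n ≤ N :=
  A0.bounded_isFSMIChain A

/-- Condition (b) (printed 2008 form) for `F₀ = N₀` of `towerN`. [cite: MochizukiFrdII2008, Prop 3.4 (viii) p.32] -/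
theorem towerN_F0_bounded_isFSMIChain (A : (towerN π).F0) :
    ∃ N : ℕ, ∀ {B : (towerN π).F0} (φ : A ⟶ B) (n : ℕ), IsFSMIChain φ n → n ≤ N :=
  N0.bounded_isFSMIChain A

/-- Condition (b) (printed 2008 form) for `F₀ = R₀` of `towerR`. [cite: MochizukiFrdII2008, Prop 3.4 (viii) p.32] -/
theorem towerR_F0_bounded_isFSMIChain (A : (towerR π).F0) :
    ∃ N : ℕ, ∀ {B : (towerR π).F0} (φ : A ⟶ B) (n : ℕ), IsFSMIChain φ n → n ≤ N :=
  R0.bounded_isFSMIChain A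

/-! ### FSMI-morphisms of `F₀` have invertible base ("complex domain and codomain", p. 32 ll. 13–14) -/

/-- An FSMI-morphism of `A₀` has invertible base in `D₀`. [cite: MochizukiFrdII2008, Prop 3.4 (viii) p.32] -/
theorem A0.isIso_base_of_isFSMI {P Q : A0} (φ : P ⟶ Q) (hφ : IsFSMI φ) : IsIso (C0.Base φ.hom) := by
  obtain ⟨hP, hQ⟩ := A0.isComplexObj_of_isFSMI φ hφ
  exact D0.isIso_of_isComplex _ hP hQ

/-- An FSMI-morphism of `N₀` has invertible base in `D₀`. [cite: MochizukiFrdII2008, Prop 3.4 (viii) p.32] -/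
theorem N0.isIso_base_of_isFSMI {P Q : N0} (φ : P ⟶ Q) (hφ : IsFSMI φ) :
    IsIso (C0.Base (N0.homCarrier φ)) := by
  obtain ⟨hP, hQ⟩ := N0.isComplexObj_of_isFSMI φ hφ
  exact D0.isIso_of_isComplex _ hP hQ

/-- An FSMI-morphism of `R₀` has invertible base in `D₀`. [cite: MochizukiFrdII2008, Prop 3.4 (viii) p.32] -/
theorem R0.isIso_base_of_isFSMI {P Q : R0} (φ : P ⟶ Q) (hφ : IsFSMI φ) :
    IsIso (C0.Base (N0.homCarrier φ.left)) := by
  obtain ⟨hP, hQ⟩ := R0.isComplexObj_of_isFSMI φ hφ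
  exact D0.isIso_of_isComplex _ hP hQ

/-- An FSMI-morphism of `A₀` is a base-isomorphism of the pre-Frobenioid `A₀ → F_0`.
[cite: MochizukiFrdII2008, Prop 3.4 (viii) p.32] -/
theorem A0.isBaseIso_of_isFSMI {P Q : A0} (φ : P ⟶ Q) (hφ : IsFSMI φ) :
    PreFrobenioid.IsBaseIso A0.toElem φ :=
  A0.isIso_base_of_isFSMI φ hφ

end ArchFrd

end

end Literature.AlgebraicGeometry.Frobenioids
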